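import Summits.NavierStokesRegularity.NavierStokesRegularity.Theorems.PerpetualPumpThesisTameDuhamelBoundParseval
import Summits.NavierStokesRegularity.NavierStokesRegularity.Theorems.PerpetualPumpThesisBesovDuhamelBoundEuler

/-!
# Stub `tameDuhamelBound` for `PerpetualPump.Thesis`, part II: the Euler form in physical space —
# the `L^∞ × L² × Ḣ¹` bound

Support file (part 2 of the stub `tameDuhamelBound` of line `SketchIdeator2`, crux
stmt-NavierStokesRegularity-1832). On divergence-free slots Tao's Euler form
`⟨B(F,G), H⟩ = -πi ∫∫ Λ(F̂(ξ₁), Ĝ(ξ₂), Ĥ(ξ₃))` (J. Amer. Math. Soc. 29 (2016), (1.3)–(1.4)) is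
`πi ∑_{j,l} ∫∫ (F̂_jĜ_l + F̂_lĜ_j)(ξ₃)_j Ĥ_l(ξ₃)` (`FA.Λ_eq_of_cdot_eq_zero`, the Fourier form of
`(u·∇)v = ∇·(u ⊗ v)`); with the `L^∞ × L² × L²` bound of part I for each piece this gives the
**localized physical-space estimate**

  `|⟨B(F,G), H⟩| ≤ 18π ‖F‖_{L^∞} ‖G‖_{L²} ‖|ξ| Ĥ‖_{L²}`

(`FB.enorm_eulerForm_le_localized`) for `F, G` divergence free with `F̂ ∈ L¹` — the building block
of the paraproduct estimate, applied there to dyadic pieces `F = Δ̇_j u`, `G = Δ̇_k v` and a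
frequency-truncated `H`.

## References

* T. Tao, J. Amer. Math. Soc. 29 (2016), 601–674, §1.1 (1.3)–(1.4) and p. 3.
* H. Bahouri, J.-Y. Chemin, R. Danchin, *Fourier Analysis and Nonlinear PDE* (2011), §2.6.
-/

noncomputable section

open MeasureTheory Filter Topology FourierTransform Real Complex
open scoped SchwartzMap ENNReal NNReal FourierTransform

set_option linter.dupNamespace false

namespace Summit.NavierStokesRegularity.NavierStokesRegularity.Theorems.PerpetualPumpThesis.FB

open Literature.Analysis.FunctionSpaces Literature.Analysis.FluidPDE
  Literature.Analysis.FluidPDE.Tao2016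

/-! ### The divergence form of the Euler integrand against `L²` factors -/

/-- **The integral of (1.3) for divergence-free slots as a sum of trilinear Fourier integrals**,
with square-integrable third factors: if `γ_{jl} = ξ_j Ĥ_l` a.e. and `γ_{jl} ∈ L²`, then
`∫∫ Λ(F̂(ξ₁), Ĝ(ξ₂), Ĥ(ξ₃)) = -∑_{j,l} [∫∫ F̂_j Ĝ_l γ_{jl}(ξ₃) + ∫∫ F̂_l Ĝ_j γ_{jl}(ξ₃)]`. -/
theorem integral_Λ_fourierFn_eq_sum {F G H : L2C} (hF : IsFourierDivFree F)
    (hG : IsFourierDivFree G) (hFi : Integrable (fourierFn F))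
    (γ : Fin 3 → Fin 3 → EuclideanSpace ℝ (Fin 3) → ℂ) (hγ2 : ∀ j l, MemLp (γ j l) 2 volume)
    (hγ : ∀ j l, γ j l =ᵐ[volume] fun ξ => EuclideanSpace.complexify ξ j * fourierFn H ξ l) :
    ∫ p : EuclideanSpace ℝ (Fin 3) × EuclideanSpace ℝ (Fin 3),
        Λ p.1 p.2 (fourierFn F p.1) (fourierFn G p.2) (fourierFn H (-p.1 - p.2)) ∂(volume.prod volume) =
      -∑ j, ∑ l,
        ((∫ p : EuclideanSpace ℝ (Fin 3) × EuclideanSpace ℝ (Fin 3),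
            fourierFn F p.1 j * (fourierFn G p.2 l * γ j l (-p.1 - p.2)) ∂(volume.prod volume)) +
          ∫ p : EuclideanSpace ℝ (Fin 3) × EuclideanSpace ℝ (Fin 3),
            fourierFn F p.1 l * (fourierFn G p.2 j * γ j l (-p.1 - p.2)) ∂(volume.prod volume)) := by
  -- adapted from `FA.integral_Λ_fourierFn_eq_sum` (part Euler of stub `besovDuhamelBound`)
  set μ : Measure (EuclideanSpace ℝ (Fin 3)) := volume with hμ
  have hF' : ∀ᵐ p : EuclideanSpace ℝ (Fin 3) × EuclideanSpace ℝ (Fin 3) ∂(μ.prod μ),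
      cdot (EuclideanSpace.complexify p.1) (fourierFn F p.1) = 0 :=
    (Measure.quasiMeasurePreserving_fst (μ := μ) (ν := μ)).ae hF
  have hG' : ∀ᵐ p : EuclideanSpace ℝ (Fin 3) × EuclideanSpace ℝ (Fin 3) ∂(μ.prod μ),
      cdot (EuclideanSpace.complexify p.2) (fourierFn G p.2) = 0 :=
    (Measure.quasiMeasurePreserving_snd (μ := μ) (ν := μ)).ae hG
  have hγ' : ∀ j l, ∀ᵐ p : EuclideanSpace ℝ (Fin 3) × EuclideanSpace ℝ (Fin 3) ∂(μ.prod μ),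
      γ j l (-p.1 - p.2) = EuclideanSpace.complexify (-p.1 - p.2) j * fourierFn H (-p.1 - p.2) l :=
    fun j l => quasiMeasurePreserving_neg_fst_sub_snd.ae_eq (hγ j l)
  have hγ'' : ∀ᵐ p : EuclideanSpace ℝ (Fin 3) × EuclideanSpace ℝ (Fin 3) ∂(μ.prod μ), ∀ j l,
      γ j l (-p.1 - p.2) = EuclideanSpace.complexify (-p.1 - p.2) j * fourierFn H (-p.1 - p.2) l := by
    rw [ae_all_iff]; intro j; rw [ae_all_iff]; intro l; exact hγ' j l
  have hpt : ∀ᵐ p : EuclideanSpace ℝ (Fin 3) × EuclideanSpace ℝ (Fin 3) ∂(μ.prod μ),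
      Λ p.1 p.2 (fourierFn F p.1) (fourierFn G p.2) (fourierFn H (-p.1 - p.2)) =
        -∑ j, ∑ l, (fourierFn F p.1 j * (fourierFn G p.2 l * γ j l (-p.1 - p.2)) +
          fourierFn F p.1 l * (fourierFn G p.2 j * γ j l (-p.1 - p.2))) := by
    filter_upwards [hF', hG', hγ''] with p h1 h2 h3
    rw [FA.Λ_eq_of_cdot_eq_zero _ _ _ _ _ h1 h2]
    congr 1
    refine Finset.sum_congr rfl fun j _ => Finset.sum_congr rfl fun l _ => ?_
    rw [h3 j l]
    ring
  have hI₁ : ∀ j l, Integrable (fun p : EuclideanSpace ℝ (Fin 3) × EuclideanSpace ℝ (Fin 3) =>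
      fourierFn F p.1 j * (fourierFn G p.2 l * γ j l (-p.1 - p.2))) (μ.prod μ) :=
    fun j l => integrable_prod_fourierFn_mul F G hFi (hγ2 j l) j l
  have hI₂ : ∀ j l, Integrable (fun p : EuclideanSpace ℝ (Fin 3) × EuclideanSpace ℝ (Fin 3) =>
      fourierFn F p.1 l * (fourierFn G p.2 j * γ j l (-p.1 - p.2))) (μ.prod μ) :=
    fun j l => integrable_prod_fourierFn_mul F G hFi (hγ2 j l) l j
  rw [integral_congr_ae hpt, integral_neg]
  congr 1
  rw [integral_finsetSum _ (fun j _ => ?_)]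
  · refine Finset.sum_congr rfl fun j _ => ?_
    rw [integral_finsetSum _ (fun l _ => ?_)]
    · exact Finset.sum_congr rfl fun l _ => integral_add (hI₁ j l) (hI₂ j l)
    · exact (hI₁ j l).add (hI₂ j l)
  · exact integrable_finsetSum _ fun l _ => (hI₁ j l).add (hI₂ j l)

/-! ### The factors `ξ_j Ĥ_l` as `L²` classes -/

/-- `ξ_j Ĥ_l(ξ)` is square integrable when `|ξ| Ĥ ∈ L²`. -/
theorem memLp_coord_mul_fourierFn (H : L2C)
    (hH : ∫⁻ ξ, (‖ξ‖ₑ * ‖fourierFn H ξ‖ₑ) ^ 2 < ⊤) (j l : Fin 3) :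
    MemLp (fun ξ : EuclideanSpace ℝ (Fin 3) => EuclideanSpace.complexify ξ j * fourierFn H ξ l) 2
      (volume : Measure (EuclideanSpace ℝ (Fin 3))) := by
  have hmeas : AEStronglyMeasurable
      (fun ξ : EuclideanSpace ℝ (Fin 3) => EuclideanSpace.complexify ξ j * fourierFn H ξ l) volume := by
    refine (Continuous.aestronglyMeasurable ?_).mul
      ((EuclideanSpace.proj (𝕜 := ℂ) l).continuous.comp_aestronglyMeasurable
        (aestronglyMeasurable_fourierFn H))
    exact (EuclideanSpace.proj (𝕜 := ℂ) j).continuous.comp EuclideanSpace.complexify.continuous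
  refine ⟨hmeas, ?_⟩
  rw [eLpNorm_eq_lintegral_rpow_enorm_toReal two_ne_zero ENNReal.ofNat_ne_top, ENNReal.toReal_ofNat]
  refine ENNReal.rpow_lt_top_of_nonneg (by norm_num) (lt_of_le_of_lt (lintegral_mono fun ξ => ?_) hH).ne
  rw [ENNReal.rpow_two, enorm_mul]
  gcongr
  · rw [← ofReal_norm, ← ofReal_norm]
    refine ENNReal.ofReal_le_ofReal ?_
    calc ‖EuclideanSpace.complexify ξ j‖ ≤ ‖EuclideanSpace.complexify ξ‖ := PiLp.norm_apply_le _ j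
      _ = ‖ξ‖ := EuclideanSpace.norm_complexify ξ
  · exact FA.enorm_le_enorm_of_norm_le (PiLp.norm_apply_le _ l)

/-- The `L²` norm of the class of `ξ_j Ĥ_l` is at most `‖|ξ| Ĥ‖_{L²}`. -/
theorem enorm_toLp_coord_mul_fourierFn_le (H : L2C)
    (hH : ∫⁻ ξ, (‖ξ‖ₑ * ‖fourierFn H ξ‖ₑ) ^ 2 < ⊤) (j l : Fin 3) :
    ‖(memLp_coord_mul_fourierFn H hH j l).toLp _‖ₑ ≤
      (∫⁻ ξ, (‖ξ‖ₑ * ‖fourierFn H ξ‖ₑ) ^ 2) ^ (1 / 2 : ℝ) := by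
  rw [enorm_Lp_two_eq_rpow]
  refine ENNReal.rpow_le_rpow ?_ (by norm_num)
  rw [lintegral_congr_ae ((memLp_coord_mul_fourierFn H hH j l).coeFn_toLp.mono fun ξ hξ => by rw [hξ])]
  refine lintegral_mono fun ξ => ?_
  rw [enorm_mul]
  gcongr
  · rw [← ofReal_norm, ← ofReal_norm]
    refine ENNReal.ofReal_le_ofReal ?_
    calc ‖EuclideanSpace.complexify ξ j‖ ≤ ‖EuclideanSpace.complexify ξ‖ := PiLp.norm_apply_le _ j
      _ = ‖ξ‖ := EuclideanSpace.norm_complexify ξ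
  · exact FA.enorm_le_enorm_of_norm_le (PiLp.norm_apply_le _ l)

/-! ### The localized physical-space bound -/

/-- **The Euler form in physical space: the `L^∞ × L² × Ḣ¹` bound.** For `F, G ∈ L²(ℝ³; ℂ³)`
divergence free with `𝓕F ∈ L¹` and `H ∈ L²` with `|ξ| Ĥ ∈ L²`,
`|⟨B(F,G), H⟩| ≤ 18π ‖F‖_{L^∞} ‖G‖_{L²} ‖|ξ| Ĥ‖_{L²}` (the `18 = 2 · 3²` trilinear pieces of the
divergence form of (1.3), each bounded by part I). -/
theorem enorm_eulerForm_le_localized {F G H : L2C} (hF : IsFourierDivFree F)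
    (hG : IsFourierDivFree G) (hFi : Integrable (fourierFn F))
    (hH : ∫⁻ ξ, (‖ξ‖ₑ * ‖fourierFn H ξ‖ₑ) ^ 2 < ⊤) :
    ‖eulerForm F G H‖ₑ ≤
      ENNReal.ofReal (18 * π) *
        eLpNorm ((F : L2C) : EuclideanSpace ℝ (Fin 3) → EuclideanSpace ℂ (Fin 3)) ∞ volume *
        ‖G‖ₑ * (∫⁻ ξ, (‖ξ‖ₑ * ‖fourierFn H ξ‖ₑ) ^ 2) ^ (1 / 2 : ℝ) := by
  set NF : ℝ≥0∞ := eLpNorm ((F : L2C) : EuclideanSpace ℝ (Fin 3) → EuclideanSpace ℂ (Fin 3)) ∞ volume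
    with hNF
  set W : ℝ≥0∞ := (∫⁻ ξ, (‖ξ‖ₑ * ‖fourierFn H ξ‖ₑ) ^ 2) ^ (1 / 2 : ℝ) with hW
  -- the `L²` classes of `ξ_j Ĥ_l`
  set c : Fin 3 → Fin 3 → Lp ℂ 2 (volume : Measure (EuclideanSpace ℝ (Fin 3))) :=
    fun j l => (memLp_coord_mul_fourierFn H hH j l).toLp _ with hc
  have hc2 : ∀ j l, MemLp ((c j l : Lp ℂ 2 (volume : Measure (EuclideanSpace ℝ (Fin 3)))) :
      EuclideanSpace ℝ (Fin 3) → ℂ) 2 volume := fun j l => Lp.memLp _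
  have hcae : ∀ j l, ((c j l : Lp ℂ 2 (volume : Measure (EuclideanSpace ℝ (Fin 3)))) :
      EuclideanSpace ℝ (Fin 3) → ℂ) =ᵐ[volume]
        fun ξ => EuclideanSpace.complexify ξ j * fourierFn H ξ l :=
    fun j l => (memLp_coord_mul_fourierFn H hH j l).coeFn_toLp
  have hcn : ∀ j l, ‖c j l‖ₑ ≤ W := fun j l => enorm_toLp_coord_mul_fourierFn_le H hH j l
  have hpi : ‖-(↑π * I)‖ₑ = ENNReal.ofReal π := by
    rw [enorm_neg, ← ofReal_norm, norm_mul, Complex.norm_real, Complex.norm_I, mul_one,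
      Real.norm_of_nonneg Real.pi_pos.le]
  have hB : ∀ j l,
      ‖(∫ p : EuclideanSpace ℝ (Fin 3) × EuclideanSpace ℝ (Fin 3),
            fourierFn F p.1 j * (fourierFn G p.2 l *
              ((c j l : Lp ℂ 2 (volume : Measure (EuclideanSpace ℝ (Fin 3)))) :
                EuclideanSpace ℝ (Fin 3) → ℂ) (-p.1 - p.2)) ∂(volume.prod volume)) +
          ∫ p : EuclideanSpace ℝ (Fin 3) × EuclideanSpace ℝ (Fin 3),
            fourierFn F p.1 l * (fourierFn G p.2 j *
              ((c j l : Lp ℂ 2 (volume : Measure (EuclideanSpace ℝ (Fin 3)))) :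
                EuclideanSpace ℝ (Fin 3) → ℂ) (-p.1 - p.2)) ∂(volume.prod volume)‖ₑ ≤
        2 * (NF * ‖G‖ₑ * W) := by
    intro j l
    rw [two_mul]
    refine (enorm_add_le _ _).trans (add_le_add ?_ ?_)
    · exact (enorm_integral_prod_fourierFn_mul_le F G hFi (c j l) j l).trans
        (mul_le_mul' le_rfl (hcn j l))
    · exact (enorm_integral_prod_fourierFn_mul_le F G hFi (c j l) l j).trans
        (mul_le_mul' le_rfl (hcn j l))
  unfold eulerForm
  rw [enorm_mul, hpi, Measure.volume_eq_prod,
    integral_Λ_fourierFn_eq_sum hF hG hFi (fun j l => ((c j l : Lp ℂ 2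
      (volume : Measure (EuclideanSpace ℝ (Fin 3)))) : EuclideanSpace ℝ (Fin 3) → ℂ)) hc2 hcae,
    enorm_neg]
  calc ENNReal.ofReal π * ‖∑ j, ∑ l,
        ((∫ p : EuclideanSpace ℝ (Fin 3) × EuclideanSpace ℝ (Fin 3),
            fourierFn F p.1 j * (fourierFn G p.2 l *
              ((c j l : Lp ℂ 2 (volume : Measure (EuclideanSpace ℝ (Fin 3)))) :
                EuclideanSpace ℝ (Fin 3) → ℂ) (-p.1 - p.2)) ∂(volume.prod volume)) +
          ∫ p : EuclideanSpace ℝ (Fin 3) × EuclideanSpace ℝ (Fin 3),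
            fourierFn F p.1 l * (fourierFn G p.2 j *
              ((c j l : Lp ℂ 2 (volume : Measure (EuclideanSpace ℝ (Fin 3)))) :
                EuclideanSpace ℝ (Fin 3) → ℂ) (-p.1 - p.2)) ∂(volume.prod volume))‖ₑ
      ≤ ENNReal.ofReal π * ∑ j : Fin 3, ∑ l : Fin 3, 2 * (NF * ‖G‖ₑ * W) := by
        gcongr
        refine (enorm_sum_le _ _).trans (Finset.sum_le_sum fun j _ => ?_)
        exact (enorm_sum_le _ _).trans (Finset.sum_le_sum fun l _ => hB j l)
    _ = ENNReal.ofReal (18 * π) * NF * ‖G‖ₑ * W := by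
        simp only [Finset.sum_const, Finset.card_univ, Fintype.card_fin, nsmul_eq_mul]
        rw [show (18 : ℝ) * π = π * 18 by ring, ENNReal.ofReal_mul Real.pi_pos.le,
          ENNReal.ofReal_ofNat]
        push_cast
        ring

end Summit.NavierStokesRegularity.NavierStokesRegularity.Theorems.PerpetualPumpThesis.FB

namespace Summit.NavierStokesRegularity.NavierStokesRegularity.Theorems.PerpetualPumpThesis

open MeasureTheory
open Literature.Analysis.FluidPDE Literature.Analysis.FluidPDE.Tao2016
open Literature.Analysis.FunctionSpaces

/-- **Part Euler of stub `tameDuhamelBound` (registered sub-goal `stub_FB_Euler`)**: the localized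
physical-space bound for Tao's Euler trilinear form on divergence-free slots,
`|⟨B(F,G), H⟩| ≤ 18π ‖F‖_{L^∞} ‖G‖_{L²} ‖|ξ| Ĥ‖_{L²}` for `F, G ∈ L²(ℝ³; ℂ³)` divergence free with
`𝓕F ∈ L¹` and `|ξ| Ĥ ∈ L²` — the building block of the paraproduct estimate of line `SketchIdeator2`. -/
theorem stub_FB_Euler : ∀ (F G H : L2C), IsFourierDivFree F → IsFourierDivFree G → Integrable (fourierFn F) volume → ∫⁻ ξ : EuclideanSpace ℝ (Fin 3), (‖ξ‖ₑ * ‖fourierFn H ξ‖ₑ) ^ 2 < ⊤ → ‖eulerForm F G H‖ₑ ≤ ENNReal.ofReal (18 * Real.pi) * eLpNorm ((F : L2C) : EuclideanSpace ℝ (Fin 3) → EuclideanSpace ℂ (Fin 3)) ⊤ volume * ‖G‖ₑ * (∫⁻ ξ : EuclideanSpace ℝ (Fin 3), (‖ξ‖ₑ * ‖fourierFn H ξ‖ₑ) ^ 2) ^ (1 / 2 : ℝ) :=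
  fun _ _ _ hF hG hFi hH => FB.enorm_eulerForm_le_localized hF hG hFi hH

end Summit.NavierStokesRegularity.NavierStokesRegularity.Theorems.PerpetualPumpThesis
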